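import Literature.MathematicalPhysics.QuantumFieldTheory.Balaban1983to89.B8Thm4ExistsAt
import Literature.MathematicalPhysics.QuantumFieldTheory.Balaban1983to89.B8Thm4SupportLocalBdry

/-!
# `Balaban1983to89.B8Thm4ExistsAtBdry` — [Balaban1985RegularSpaces] THEOREM 4 (p. 88), EXISTENCE HALF PER DATUM with the three socket BODIES
# at the datum, the (1.59) body IN THE REPAIRED CURRENCY (exterior-collar term, located repair R-d)

statement-level skeleton of published theorems with citation tags; proofs where landed; nothing here is a claim about the
Yang–Mills mass gap

PDF held: `paper:balaban1985-cmp99-regular-spaces-gauge-fixing` (journal page = PDF page + 74); pp. 81–82, 86–88, 94–95.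

CITATION HEADER (lean-in-tree rule).  Cell `pub-ymgap` (YM Track A, HUMAN RULING D-0062), DAG node N05 = [B8], seat `pub-ymgap-dag-n05-e`
(R141 (C) fan-out, row s3b), generation g6.  WHY: the per-datum existence driver `B8Thm4ExistsAt.thm4Exists_concrete_at` (this seat's g2) is
the entry point of the FLAT currency for Proposition 6 (`B8Prop6CubeMemberFlat3` → `…FlatScalar` → the ⊗-id transfer of g5): its (1.59) body
at the datum `(1, U₀″)` is the display certified false at the cube member (`B8SockH59CornerDefect.h59₁_false_at_one_cubeMember`).  THIS FILE is
the same driver with the (1.59) body in the repaired currency — the datum-level entry of the flat line in a non-refuted shape.  Kind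
«kernel-checked proof», theorems only, no `def`.

HONEST SCOPE.  By-name re-run; the three bodies are HYPOTHESES at the datum; `B_∂`, `4B_∂ ≤ (dL − 1)B₀` are the tree's.  Count-neutral; N05 NOT
discharged; one finite `𝕋⁴` programme at fixed `ε`, Bałaban as printed; nothing continuum ∕ ℝ⁴ ∕ OS ∕ mass-gap ∕ Clay.  Unit
`pub-ymgap-dag-n05-e` (g6), 2026-08-27.
-/

noncomputable section

open NormedSpace

namespace Literature.MathematicalPhysics.QuantumFieldTheory.Balaban1983to89.B8Thm4ExistsAtBdry

open Complex (I)
open MatrixLog B7Prop1Explicit B7Prop2Explicit B7Prop1Local B7Eq92Concrete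
open B7Prop2Explicit (C0 c2')
open B7Prop3Flat (c3)
open B8Ineq132 (covDerivFwd InAk BondTouches)
open B8Eq119TwistedAxial (Restr129 InAx)
open B8Eq184Proof (gaugeExp cfgExp)
open B8Lemma1NonAbelian (mulCfg)
open B8Eq140Level (SideTouches)
open B8Eq146AExpansion (iEta)
open B7Prop4GeneralLevels (logCovIter linCovIter)
open B8Eq155JBound (Jcur wsup)
open B8ScaledSupNorm (bondNorm msup)
open B8Thm2LogB (blockTop)
open B8Ineq130 (tlo thi)
open B8Eq138LandauZd (IsLandau138W logCfg)
open B8Prop3GaugeFixedKLevel (eq_mgauge_inv_of_mgauge_eq mem_unitaryUnits_of_mgauge_eq logField_spec)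
open B8Thm4SupportLocalBdry (thm4_exists_all_levels_supp_landau138_bdry)
open B8Thm4Windows (thm4_windows thm4_windows_extra)

export B7Prop1Explicit (Site)

variable {d : ℕ}

variable {𝔸 : Type*} [CStarAlgebra 𝔸] [Nontrivial 𝔸]

/-- **THEOREM 4 (p. 88), EXISTENCE HALF, IN THE LEAF'S QUANTIFIER SHAPE, THREE SOCKET BODIES AT THE DATUM, THE (1.59) BODY IN THE REPAIRED
CURRENCY** — this seat's g2 `B8Thm4ExistsAt.thm4Exists_concrete_at` with the (1.59) body carrying the support clause «`u = 1` off `Ω₀`» and the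
level-0 exterior-collar term `+ B_∂·Φ₀(A′)` on both lines, and the constant side condition `0 ≤ B_∂`, `4B_∂ ≤ (dL − 1)B₀`; threshold and
conclusion byte-identical (driver: `B8Thm4SupportLocalBdry.thm4_exists_all_levels_supp_landau138_bdry`).
[cite: Balaban1985RegularSpaces, Thm 4 p.88, (1.29) p.81, (1.38) p.82, (1.58)–(1.62) pp.86–87, Prop. 5 (1.107)–(1.108) p.94, pp.94–95] -/
theorem thm4Exists_concrete_at_bdry (hd2 : 2 ≤ d) {L : ℕ} (hL : 2 ≤ L)
    {B₀ B₀' Bbd : ℝ} (hB₀ : 0 < B₀) (hB₀' : 0 < B₀') (hB : 2 ≤ 5 * (d : ℝ) * L * B₀) (hBbd : 0 ≤ Bbd) (hBd : 4 * Bbd ≤ ((d : ℝ) * L - 1) * B₀) :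
    ∃ c₁ : ℝ, 0 < c₁ ∧ ∀ (η : ℝ), 0 < η → ∀ (k : ℕ)
    (Ω : ℕ → Set (Site d)) (hΩ : ∀ j, Ω (j + 1) ⊆ Ω j) (Λs : ℕ → ℕ → Set (Site d)) (Λb : ℕ → ℕ → Set (Site d × Fin d))
    (hbox : ∀ m, m ≤ k → ∀ j, j ≤ m → ∀ c ∈ Λb m j, ∀ x, InBox (loK L j c.1) (bondHiK L j c.1 c.2) x → x ∈ Ω j)
    (hclass : ∀ m, m ≤ k → ∀ j, j ≤ m → ∀ c ∈ Λb m j,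
      (c.1 ∈ Λs m j ∧ c.1 + e c.2 ∈ Λs m j) ∨
      (∃ j', j = j' + 1 ∧ (∀ x, (L : ℤ) • c.1 ≤ x → x ≤ (L : ℤ) • c.1 + blockTop L → x ∈ Λs m j') ∧ c.1 + e c.2 ∈ Λs m j) ∨
      (∃ j', j = j' + 1 ∧ c.1 ∈ Λs m j ∧ (∀ x, (L : ℤ) • (c.1 + e c.2) ≤ x → x ≤ (L : ℤ) • (c.1 + e c.2) + blockTop L → x ∈ Λs m j'))),
      ∀ α₀ α₁ : ℝ, 0 < α₀ → 0 < α₁ → α₀ + α₁ ≤ c₁ →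
      ∀ U₀ U' : Site d → Fin d → 𝔸ˣ, (∀ x κ, U₀ x κ ∈ unitaryUnits 𝔸) → (∀ x κ, U' x κ ∈ unitaryUnits 𝔸) →
      InAk L k η α₀ Ω U₀ → InAk L k η α₀ Ω (mulCfg U' U₀) → (∀ m, m ≤ k → InAx L m (Λs m) U₀ (mulCfg U' U₀)) →
      (∀ j, j ≤ k → ∀ (z : Site d) (μ : Fin d), (∀ x, InBox (loK L j z) (bondHiK L j z μ) x → x ∈ Ω j) →
        ‖(avgIter L (mulCfg U' U₀) j z μ : 𝔸) - (avgIter L U₀ j z μ : 𝔸)‖ ≤ α₁) →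
      (∀ b ∈ {b : Site d × Fin d | SideTouches (Ω 0) b.1 b.2}, ‖((U' b.1 b.2 : 𝔸ˣ) : 𝔸) - 1‖ ≤ α₁) →
      -- Proposition 5's fixed point at the base level, over THIS datum
      ((∃ (v : Site d → 𝔸ˣ) (lam : Site d → 𝔸), (∀ x, v x ∈ unitaryUnits 𝔸) ∧ (∀ x, x ∉ Ω 0 → v x = 1) ∧
        (∀ j, j ≤ 1 → ∀ b ∈ {b : Site d × Fin d | SideTouches (Ω j) b.1 b.2}, (v b.1 : 𝔸) = ((gaugeExp lam b.1 : 𝔸ˣ) : 𝔸) ∧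
        (v (b.1 + e b.2) : 𝔸) = ((gaugeExp lam (b.1 + e b.2) : 𝔸ˣ) : 𝔸)) ∧
        (∀ j, j ≤ 1 → ∀ b ∈ {b : Site d × Fin d | SideTouches (Ω j) b.1 b.2},
        ‖lam b.1‖ ≤ (8 * B₀' * (5 * (d : ℝ) * L * B₀) * (α₀ + α₁)) ∧ ((L : ℝ) ^ j * η) * ‖covDerivFwd η U₀ b.2 lam b.1‖ ≤ (8 * B₀' * (5 * (d : ℝ) * L * B₀) * (α₀ + α₁))) ∧
        IsLandau138W L 1 η (Ω 0) (Λs 1) U₀ (mgauge U₀ v⁻¹ U') ∧ Restr129 L 1 (Λs 1) U₀ ((1 : Site d → 𝔸ˣ) * v))) →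
      -- Proposition 5's fixed point at every intermediate level, over THIS datum
      ((∀ m, 1 ≤ m → m < k → ∀ (u₁ : Site d → 𝔸ˣ) (U₁ : Site d → Fin d → 𝔸ˣ) (A : Site d → Fin d → 𝔸),
        (∀ x, u₁ x ∈ unitaryUnits 𝔸) → (∀ x, x ∉ Ω 0 → u₁ x = 1) → mgauge U₀ u₁ U₁ = U' → Restr129 L m (Λs m) U₀ u₁ →
        IsLandau138W L m η (Ω 0) (Λs m) U₀ U₁ →
        (∀ j, j ≤ m → ∀ b ∈ {b : Site d × Fin d | SideTouches (Ω j) b.1 b.2},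
        U₁ b.1 b.2 = cfgExp η A b.1 b.2 ∧ IsSelfAdjoint (A b.1 b.2) ∧ ‖A b.1 b.2‖ ≤ (5 * (d : ℝ) * L * B₀ * (α₀ + α₁)) * ((L : ℝ) ^ j * η)⁻¹) →
        ∃ (v : Site d → 𝔸ˣ) (lam : Site d → 𝔸), (∀ x, v x ∈ unitaryUnits 𝔸) ∧ (∀ x, x ∉ Ω 0 → v x = 1) ∧
        (∀ j, j ≤ m + 1 → ∀ b ∈ {b : Site d × Fin d | SideTouches (Ω j) b.1 b.2}, (v b.1 : 𝔸) = ((gaugeExp lam b.1 : 𝔸ˣ) : 𝔸) ∧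
        (v (b.1 + e b.2) : 𝔸) = ((gaugeExp lam (b.1 + e b.2) : 𝔸ˣ) : 𝔸)) ∧
        (∀ j, j ≤ m + 1 → ∀ b ∈ {b : Site d × Fin d | SideTouches (Ω j) b.1 b.2},
        ‖lam b.1‖ ≤ (8 * B₀' * (5 * (d : ℝ) * L * B₀) * (α₀ + α₁)) ∧ ((L : ℝ) ^ j * η) * ‖covDerivFwd η U₀ b.2 lam b.1‖ ≤ (8 * B₀' * (5 * (d : ℝ) * L * B₀) * (α₀ + α₁))) ∧
        IsLandau138W L (m + 1) η (Ω 0) (Λs (m + 1)) U₀ (mgauge U₀ v⁻¹ U₁) ∧ Restr129 L (m + 1) (Λs (m + 1)) U₀ (u₁ * v))) →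
      -- (1.59) for the fields gauge-related to THIS `U′` over THIS `U₀`
      ((∀ m, 1 ≤ m → m ≤ k → ∀ (u : Site d → 𝔸ˣ) (W : Site d → Fin d → 𝔸ˣ) (A' : Site d → Fin d → 𝔸),
        (∀ x, u x ∈ unitaryUnits 𝔸) → (∀ x, x ∉ Ω 0 → u x = 1) → mgauge U₀ u W = U' → Restr129 L m (Λs m) U₀ u →
        IsLandau138W L m η (Ω 0) (Λs m) U₀ W → (∀ y τ, IsSelfAdjoint (A' y τ)) →
        (∀ j, j ≤ m → ∀ y τ, SideTouches (Ω j) y τ →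
        W y τ = cfgExp η A' y τ ∧ ‖A' y τ‖ ≤ (2 * (L * (5 * (d : ℝ) * L * B₀ * (α₀ + α₁))) + 8 * (8 * B₀' * (5 * (d : ℝ) * L * B₀) * (α₀ + α₁))) * ((L : ℝ) ^ j * η)⁻¹) →
        (∀ y τ, (∀ j, j ≤ m → ¬ SideTouches (Ω j) y τ) → A' y τ = 0) →
        msup L m η (-(1 : ℝ)) (fun j (b : Site d × Fin d) => SideTouches (Ω j) b.1 b.2) (fun b => A' b.1 b.2)
        ≤ B₀ * (bondNorm L m η (-(3 : ℝ)) Ω (fun x μ => Jcur η U₀ A' μ x)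
        + wsup 1 (fun p : {p : ℕ × (Site d × Fin d) // p.1 ≤ m ∧ p.2 ∈ Λb m p.1} =>
        linCovIter L U₀ (iEta η A') p.1.1 p.1.2.1 p.1.2.2))
        + Bbd * msup L m η (-(1 : ℝ)) (fun j (b : Site d × Fin d) => j = 0 ∧ SideTouches (Ω 0) b.1 b.2 ∧ ¬ BondTouches (Ω 0) b.1 b.2)
            (fun b => A' b.1 b.2) ∧
        msup L m η (-(2 : ℝ)) (fun j (t : Fin d × Fin d × Site d) => SideTouches (Ω j) t.2.2 t.2.1)
        (fun t => covDerivFwd η U₀ t.1 (fun z => A' z t.2.1) t.2.2)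
        ≤ B₀ * (bondNorm L m η (-(3 : ℝ)) Ω (fun x μ => Jcur η U₀ A' μ x)
        + wsup 1 (fun p : {p : ℕ × (Site d × Fin d) // p.1 ≤ m ∧ p.2 ∈ Λb m p.1} =>
        linCovIter L U₀ (iEta η A') p.1.1 p.1.2.1 p.1.2.2))
        + Bbd * msup L m η (-(1 : ℝ)) (fun j (b : Site d × Fin d) => j = 0 ∧ SideTouches (Ω 0) b.1 b.2 ∧ ¬ BondTouches (Ω 0) b.1 b.2)
            (fun b => A' b.1 b.2))) →
      ∃ u : Site d → 𝔸ˣ, (∀ x, u x ∈ unitaryUnits 𝔸) ∧ (∀ x, x ∉ Ω 0 → u x = 1) ∧ Restr129 L k (Λs k) U₀ u ∧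
        (1 ≤ k → IsLandau138W L k η (Ω 0) (Λs k) U₀ (mgauge U₀ u⁻¹ U')) ∧
        (∀ j, j ≤ k → ∀ b ∈ {b : Site d × Fin d | SideTouches (Ω j) b.1 b.2},
          mgauge U₀ u⁻¹ U' b.1 b.2 = cfgExp η (logCfg η (mgauge U₀ u⁻¹ U')) b.1 b.2 ∧
            IsSelfAdjoint (logCfg η (mgauge U₀ u⁻¹ U') b.1 b.2) ∧
            ‖logCfg η (mgauge U₀ u⁻¹ U') b.1 b.2‖ ≤ (5 * (d : ℝ) * L * B₀ * (α₀ + α₁)) * ((L : ℝ) ^ j * η)⁻¹) := by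
  have hL1 : 1 ≤ L := le_trans (by norm_num) hL
  have hd1 : 1 ≤ d := le_trans (by norm_num) hd2
  have hL' : (1 : ℝ) ≤ L := by exact_mod_cast hL1
  obtain ⟨c₁, hc₁, hw⟩ := thm4_windows hd1 hL1 hB₀ hB₀' hB
  obtain ⟨c₂, hc₂, hw'⟩ := thm4_windows_extra (d := d) hL1
  refine ⟨min c₁ c₂, lt_min hc₁ hc₂, ?_⟩
  intro η hη k Ω hΩ Λs Λb hbox hclass α₀ α₁ hα₀ hα₁ hS U₀ U' hU₀ hU' h33 h34 hAx h135 h66 P5base P5 H59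
  have hS1 : α₀ + α₁ ≤ c₁ := hS.trans (min_le_left _ _)
  have hS2 : α₀ + α₁ ≤ c₂ := hS.trans (min_le_right _ _)
  obtain ⟨w1, w2, w3, w4, w5, w6, w7, w8, w9, w10, w11, w12, w13, w14, -⟩ :=
    hw α₀ α₁ hα₀ hα₁ hS1 (5 * (d : ℝ) * L * B₀ * (α₀ + α₁)) (8 * B₀' * (5 * (d : ℝ) * L * B₀) * (α₀ + α₁)) rfl rfl
  obtain ⟨w19, -⟩ := hw' α₀ α₁ hα₀ hα₁ hS2
  have hcs0 : 0 ≤ 5 * (d : ℝ) * L * B₀ * (α₀ + α₁) := by positivity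
  have hα₄0 : 0 ≤ 8 * B₀' * (5 * (d : ℝ) * L * B₀) * (α₀ + α₁) := by positivity
  -- EXISTENCE (support form) at the top level `k`
  have hbdry : 4 * Bbd * α₁ ≤ ((d : ℝ) * L - 1) * B₀ * (α₀ + α₁) := by
    have h1 : 4 * Bbd * α₁ ≤ ((d : ℝ) * L - 1) * B₀ * α₁ := mul_le_mul_of_nonneg_right hBd hα₁.le
    have h2 : 0 ≤ ((d : ℝ) * L - 1) * B₀ := le_trans (by positivity) hBd
    have h3 : ((d : ℝ) * L - 1) * B₀ * α₁ ≤ ((d : ℝ) * L - 1) * B₀ * (α₀ + α₁) :=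
      mul_le_mul_of_nonneg_left (le_add_of_nonneg_left hα₀.le) h2
    exact h1.trans h3
  obtain ⟨u, hu, huS, h129, W, hW, hLan, A, hA⟩ := thm4_exists_all_levels_supp_landau138_bdry hd2 hη hL k hU₀ hU' hα₀ hα₁ hα₄0 hB₀.le
    rfl w1 w2 w3 w4 w5 w6 w7 w8 w9 w10 w11 w12 w19 hBbd hα₁.le hbdry w13 w14 Ω hΩ Λs Λb hbox hclass h33 h34 hAx h135 h66 P5base P5 H59 k le_rfl
  have hWeq : W = mgauge U₀ u⁻¹ U' := eq_mgauge_inv_of_mgauge_eq hW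
  have hWu : ∀ x κ, W x κ ∈ unitaryUnits 𝔸 := mem_unitaryUnits_of_mgauge_eq hU₀ hU' hu hW
  -- `c⋆ ≤ 1/16` for the logarithm device
  have hc16 : 5 * (d : ℝ) * L * B₀ * (α₀ + α₁) ≤ 1 / 16 := by
    have h₁ : (1 : ℝ) * (5 * (d : ℝ) * L * B₀ * (α₀ + α₁)) ≤ L * (5 * (d : ℝ) * L * B₀ * (α₀ + α₁)) :=
      mul_le_mul_of_nonneg_right hL' hcs0
    linarith
  -- the exponent read back as `logCfg`
  have hleaf : ∀ j, j ≤ k → ∀ b ∈ {b : Site d × Fin d | SideTouches (Ω j) b.1 b.2},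
      mgauge U₀ u⁻¹ U' b.1 b.2 = cfgExp η (logCfg η (mgauge U₀ u⁻¹ U')) b.1 b.2 ∧
        IsSelfAdjoint (logCfg η (mgauge U₀ u⁻¹ U') b.1 b.2) ∧
        ‖logCfg η (mgauge U₀ u⁻¹ U') b.1 b.2‖ ≤ (5 * (d : ℝ) * L * B₀ * (α₀ + α₁)) * ((L : ℝ) ^ j * η)⁻¹ := by
    intro j hj b hb
    obtain ⟨hexp, -, hbd⟩ := hA j hj b hb
    have hbd' : ‖A b.1 b.2‖ ≤ (5 * (d : ℝ) * L * B₀ * (α₀ + α₁)) * η⁻¹ := by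
      refine hbd.trans ?_
      have hLj : (1 : ℝ) ≤ (L : ℝ) ^ j := one_le_pow₀ hL'
      have : ((L : ℝ) ^ j * η)⁻¹ ≤ η⁻¹ := by
        rw [mul_inv]
        calc ((L : ℝ) ^ j)⁻¹ * η⁻¹ ≤ 1 * η⁻¹ := by gcongr; exact inv_le_one_of_one_le₀ hLj
          _ = η⁻¹ := one_mul _
      exact mul_le_mul_of_nonneg_left this hcs0
    obtain ⟨hlogA, hsa, hWexp⟩ := logField_spec hη U₀ hWu hexp hbd' hc16
    rw [← hWeq]
    refine ⟨hWexp, ?_, ?_⟩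
    · simpa [logCfg] using hsa
    · show ‖logCfg η W b.1 b.2‖ ≤ _
      rw [logCfg, hlogA]
      exact hbd
  exact ⟨u, hu, huS, h129, fun hk => hWeq ▸ hLan hk, hleaf⟩

#print axioms thm4Exists_concrete_at_bdry

end Literature.MathematicalPhysics.QuantumFieldTheory.Balaban1983to89.B8Thm4ExistsAtBdry

end
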